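import Literature.AlgebraicGeometry.Resolution.EmbeddedResolutionCentre
import Literature.AlgebraicGeometry.Resolution.BlowupSequences
import Literature.AlgebraicGeometry.Resolution.MarkedIdealsLemmas
import Literature.AlgebraicGeometry.Resolution.EffectiveResolutionProofs
import HarnessLib

/-!
# A resolution of the marked ideal `(X, 𝓘_Y, E, 1)` desingularizes `Y` (BGMW 2011, §3.3 (1) ⇒ (4))

Topic: `Literature/AlgebraicGeometry/Resolution`. Third layer of the decomposition of the named
fact `BierstoneGrigorievMilmanWlodarczyk2011` (`EffectiveResolution.lean`; Bierstone–Grigoriev–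
Milman–Włodarczyk, *Effective Hironaka resolution and its complexity (with appendix on
applications in positive characteristic)*, arXiv:1206.3090, Cor. 8.0.6 = Cor. 7.0.6 of Asian J.
Math. 15 (2011)), which shortens its critical path.

BGMW §3.3 ("Hironaka resolution principle", p. 7): (1) resolution of marked ideals ⇒ (2)
principalization ⇒ (3) weak embedded desingularization ⇒ (4) desingularization; for (2) ⇒ (3):
"in the course of the principalization of `𝓘_Y`, the strict transform `Y_i` of `Y` in some `X_i`
is the center of a blow-up. At this stage `Y_i` is nonsingular". The faithful embedded statement
(Thm. 2.0.2 (2): all centres avoid `Reg(Y)`) needs the *functoriality* of the canonical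
resolution with respect to open immersions (Thm. 8.0.5 (2)). The WEAK conclusion vendored in
`BierstoneGrigorievMilmanWlodarczyk2011` (a proper birational morphism from a regular scheme,
`Scheme.HasResolution`) does not: this file PROVES, over Mathlib, for a closed immersion
`ι : Y ↪ X` of an integral scheme into a locally Noetherian scheme and ANY resolution of the
marked ideal `(X, 𝓘_Y, E, 1)` in the sense of `MarkedIdeals.lean` (`IsMarkedResolution`: blow-ups
with regular centres `Cᵢ ⊆ supp(𝓘ᵢ, 1)` having snc with `Eᵢ`, ending with `supp(𝓘_r, 1) = ∅`),
that `Y` has a resolution of singularities (`IsMarkedResolution.hasResolution`). Argument (the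
one of Kollár 2007, proof of Cor. 3.22, in the language of `EmbeddedResolution.lean`): let `ξ`
be the generic point of `ι(Y)`; as long as no centre passes through the point `ξ'ᵢ` over `ξ`, the
sequence is an embedded transform over `T = {ξ}ᶜ` (`IsEmbeddedTransform`) and `ξ'ᵢ` stays in
`V(𝓘ᵢ)` (off the exceptional divisor the controlled transform is the total transform:
`mem_support_colon_of_not_mem_support`); since `V(𝓘_r) = ∅`, some first centre `C_j ∋ ξ'_j`; it
is regular and lies over `V(𝓘) = ι(Y)` (`Cⱼ ⊆ supp ⊆ V(𝓘ⱼ) ⊆ σ⁻¹V(𝓘)`), so the strict transform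
of `Y` with its reduced structure is regular (`IsEmbeddedTransform.isRegular_subscheme_of_centre`,
BGMW §3.3 (2) ⇒ (3)) and `hasResolution_of_isEmbeddedTransform` (BGMW §3.3 (3) ⇒ (4)) applies.

Consequently the named fact reduces to the mere EXISTENCE of resolutions of the marked ideals
`(𝔸ⁿ_k, (S)·𝒪, ∅, 1)` in characteristic `p > M(d, n, l)` — BGMW Thm. 8.0.5 (existence clause)
with Lemma 8.0.3 (1) and the Galois-descent Remark (p. 23), the statement behind Cor. 8.0.7
(canonical principalization in large characteristic), weaker than printed (canonicity and
functoriality (1)–(2) of Thm. 8.0.5 dropped, smooth centres recorded as regular): the reduction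
`bierstoneGrigorievMilmanWlodarczyk2011_of_marked`, PROVED, takes that statement as its EXPLICIT
HYPOTHESIS. (The embedded form `BierstoneGrigorievMilmanWlodarczyk2011_embedded` of
`EmbeddedResolution.lean` remains a true, stronger side statement.)

Design note (decomposition review under D-0026, 2026-08-15). From its first revision this file
vendored that hypothesis as a separate named fact `BierstoneGrigorievMilmanWlodarczyk2011_marked`.
The review MERGED it back into the proof obligation of `BierstoneGrigorievMilmanWlodarczyk2011`:
(i) it is all of Cor. 8.0.6 except its last step (the one proved here) — Hironaka's
principalization in large characteristic, a theory (BGMW §4 with the §§5–8 multiplicity bound, or the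
characteristic-zero algorithm plus spreading out), not an M-sized published lemma, so the cut
isolated none of the difficulty; (ii) nothing consumed it as a hypothesis except the reduction
below; (iii) the parent has meanwhile been reduced, with proved glue and WITHOUT it, to the
characteristic-zero named facts the tree's `Hironaka1964` rests on
(`bierstoneGrigorievMilmanWlodarczyk2011_of_kollar : Kollar2007MarkedOrderReduction → …`,
`EffectiveResolutionCharZeroReduction.lean`, resolution in characteristic zero spread out over
`Spec ℤ[c]`; `bierstoneGrigorievMilmanWlodarczyk2011_of_kollarThms : Kollar2007Thm3_103 →
Kollar2007Thm3_107 → …`, `EffectiveResolutionKollarLeaves.lean`). The statement itself stays in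
the tree verbatim and unweakened: as the hypothesis of `bierstoneGrigorievMilmanWlodarczyk2011_of_marked`
here, and as the PROVED conclusion of `marked_of_kollar_of_spreads` (`EffectiveResolutionSpread.lean`:
from `Kollar2007MarkedOrderReduction` and the marked spreading-out step) and of
`bierstoneGrigorievMilmanWlodarczyk2011_marked_of_canonical` (`CanonicalResolution.lean`: from the
canonical fact `BierstoneGrigorievMilmanWlodarczyk2011_canonical`, which the embedded form needs).
No named fact is declared in this file.

## Content

* `mem_support_colon_of_not_mem_support` — off `V(P)` the colon ideal sheaf `(L : P)` has the
  same support as `L` [folklore];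
* `IsMultipleBlowup.isEmbeddedTransform_or_isRegular` — the dichotomy along a multiple
  blow-up of a marked ideal `(X, 𝓘, E, 1)` with `V(𝓘) ⊆ closure {ξ} ∋ ξ`: either some centre has
  swallowed the strict transform of `closure {ξ}` (which is then regular), or the sequence is an
  embedded transform over `{ξ}ᶜ` and the point over `ξ` is still in `V(𝓘_r)` [folklore]; its
  counterpart in the centred-sequence vocabulary of `PrincipalizationToResolution.lean` is
  `IsRegularCentredSequence.exists_first_centre` / `hasResolution_of_centre_through_genericPoint`;
* `IsMarkedResolution.hasResolution` — BGMW §3.3 (1) ⇒ (4), weak form, PROVED;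
* `bierstoneGrigorievMilmanWlodarczyk2011_of_marked` — PROVED: resolutions of the marked ideals
  `(𝔸ⁿ_k, (S), ∅, 1)` for `k` perfect of characteristic `p > M(d, n, l)` (Thm. 8.0.5 existence /
  Cor. 8.0.7, as an explicit hypothesis) imply `BierstoneGrigorievMilmanWlodarczyk2011` (Cor. 8.0.6).

## Sources

* E. Bierstone, D. Grigoriev, P. Milman, J. Włodarczyk, arXiv:1206.3090 (arXiv numbering):
  Def. 3.1.3, §3.3 (p. 7), Lemma 8.0.3, Thm. 8.0.5, Remark, Cor. 8.0.6, Cor. 8.0.7 (p. 23).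
  [BierstoneGrigorievMilmanWlodarczyk2011]
* J. Kollár, *Lectures on Resolution of Singularities* (2007), proof of Cor. 3.22 (pp. 124–125).
  [Kollar2007]
-/

noncomputable section

open CategoryTheory CategoryTheory.Limits AlgebraicGeometry TopologicalSpace Topology

namespace Literature.AlgebraicGeometry.Resolution

universe u

/-! ## Supports of colon ideal sheaves off the divisor -/

/-- Off `V(P)`, the colon ideal sheaf `(L : P)` has the support of `L`: if `x ∈ V(L)` and
`x ∉ V(P)` then `x ∈ V((L : P))` (on stalks, `P_x = 𝒪_{X,x}` and `P_x · (L : P)_x ⊆ L_x ⊆ 𝔪_x`).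
In particular, off the exceptional divisor the controlled transform `(σ^*𝓘 : 𝓘(D)^μ)` cuts out
the total transform. [folklore] -/
theorem mem_support_colon_of_not_mem_support {X : Scheme.{u}} {L P : X.IdealSheafData} {x : X}
    (hL : x ∈ L.support) (hP : x ∉ P.support) : x ∈ (colon L P).support := by
  rw [mem_support_iff_stalkIdeal_le] at hL ⊢
  have h1 : stalkIdeal (P * colon L P) x ≤ stalkIdeal L x := stalkIdeal_mono (mul_colon_le L P) x
  rw [stalkIdeal_mul, stalkIdeal_eq_top_of_not_mem_support hP, Ideal.top_mul] at h1
  exact h1.trans hL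

/-! ## The dichotomy along a multiple blow-up of `(X, 𝓘, E, 1)` -/

/-- **The first centre through the point over the generic point.** Let `X` be locally
Noetherian, `ξ ∈ X`, and `M = (X, 𝓘, E, 1)` a marked ideal of multiplicity one with
`ξ ∈ V(𝓘) ⊆ closure {ξ}` (i.e. `V(𝓘) = closure {ξ}`). Along any multiple blow-up
`σ : X' → X` of `M` (`IsMultipleBlowup M σ M'`), EITHER some initial segment `σ'` of the sequence
is an embedded transform of `closure {ξ}` over `T = {ξ}ᶜ` whose strict transform, with its
reduced structure, is a regular scheme (this happens as soon as a centre passes through the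
point over `ξ`: that centre is regular and lies over `V(𝓘)`, BGMW §3.3 (2) ⇒ (3),
`IsEmbeddedTransform.isRegular_subscheme_of_centre`), OR no centre has passed through the point
over `ξ` yet: `σ` itself is an embedded transform of `closure {ξ}` over `{ξ}ᶜ`, and the unique
point `ξ'` over `ξ` lies in `V(𝓘')`, `𝓘'` the controlled transform, with `V(𝓘') ⊆ σ⁻¹(closure {ξ})`
(off the exceptional divisors the controlled transform is the total transform). (Kollár 2007,
proof of Cor. 3.22: "there is a unique `j` such that `P_j → P` is a local isomorphism around
`η_X` but the centre `Z_j ∋ η_X`".) [folklore] -/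
theorem IsMultipleBlowup.isEmbeddedTransform_or_isRegular {X : Scheme.{u}} [IsLocallyNoetherian X]
    {ξ : X} {M : MarkedIdeal X} (hμ : M.mult = 1) (hξ : ξ ∈ M.ideal.support)
    (hV : (M.ideal.support : Set X) ⊆ closure {ξ}) {X' : Scheme.{u}} {σ : X' ⟶ X}
    {M' : MarkedIdeal X'} (h : IsMultipleBlowup M σ M') :
    (∃ (X'' : Scheme.{u}) (σ' : X'' ⟶ X) (Y' : Set X''),
        IsEmbeddedTransform (closure {ξ}) {ξ}ᶜ σ' Y' ∧
          Scheme.IsRegular (Scheme.IdealSheafData.vanishingIdeal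
            (⟨closure Y', isClosed_closure⟩ : Closeds X'')).subscheme) ∨
      (∃ (Y' : Set X') (ξ' : X'), IsEmbeddedTransform (closure {ξ}) {ξ}ᶜ σ Y' ∧ σ ξ' = ξ ∧
        ξ' ∈ M'.ideal.support ∧ (M'.ideal.support : Set X') ⊆ σ ⁻¹' closure {ξ} ∧
        M'.mult = 1) := by
  have hξT : ξ ∉ ({ξ}ᶜ : Set X) := by simp
  induction h with
  | refl => exact Or.inr ⟨closure {ξ}, ξ, IsEmbeddedTransform.refl, rfl, hξ, hV, hμ⟩
  | @blowup X' X'' σ M' h C τ hτ hC hsupp hsnc ih =>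
    rcases ih with hdone | ⟨Y', ξ', hET, hξ', hξ'V, hV', hμ'⟩
    · exact Or.inl hdone
    obtain ⟨hσ, V, hTV, hiso, -⟩ := hET.isProper_and_exists stacks02NS_holds hξT
    haveI : IsLocallyNoetherian X' := LocallyOfFiniteType.isLocallyNoetherian σ
    -- the centre lies over `V(𝓘) ⊆ closure {ξ}`
    have hCV : (C.support : Set X') ⊆ σ ⁻¹' closure {ξ} :=
      (hsupp.trans (M'.support_subset_support_ideal (by omega))).trans hV'
    have hCY : σ '' (C.support : Set X') ⊆ closure {ξ} := Set.image_subset_iff.mpr hCV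
    by_cases hξ'C : ξ' ∈ (C.support : Set X')
    · -- the centre passes through the point over `ξ`: the strict transform is regular
      refine Or.inl ⟨X', σ, Y', hET, ?_⟩
      exact hET.isRegular_subscheme_of_centre hξT C hC hCY ⟨ξ', hξ'C, hξ'⟩
    · -- the centre misses the point over `ξ`, hence lies over `{ξ}ᶜ`
      have hξV : ξ ∈ V := hTV hξT
      have hfib : ∀ x : X', σ x = ξ → x = ξ' := by
        obtain ⟨x₀, -, huniq⟩ := existsUnique_preimage_of_isIso_morphismRestrict σ hiso hξV
        intro x hx
        exact (huniq x hx).trans (huniq ξ' hξ').symm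
      have hT : σ '' (C.support : Set X') ⊆ {ξ}ᶜ := by
        rintro _ ⟨x, hxC, rfl⟩ (hx : σ x = ξ)
        exact hξ'C (hfib x hx ▸ hxC)
      -- the unique point over `ξ'` (the blow-up is an isomorphism off its centre)
      let Wc : X'.Opens := ⟨(C.support : Set X')ᶜ, C.support.isClosed.isOpen_compl⟩
      have hWc : IsIso (τ ∣_ Wc) := hτ.isIso_morphismRestrict disjoint_compl_left
      obtain ⟨ξ'', hξ'', -⟩ :=
        existsUnique_preimage_of_isIso_morphismRestrict τ hWc (y := ξ') hξ'C
      refine Or.inr ⟨_, ξ'', IsEmbeddedTransform.blowup hET C τ hτ hC hT,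
        by rw [Scheme.Hom.comp_apply, hξ'', hξ'], ?_, ?_, by simpa using hμ'⟩
      · -- `ξ''` is off the exceptional divisor, where `𝓘'' = τ^* 𝓘'`
        rw [MarkedIdeal.transform_ideal, hμ', controlledTransform, pow_one]
        refine mem_support_colon_of_not_mem_support ?_ ?_
        · rw [Scheme.IdealSheafData.support_comap]
          show τ ξ'' ∈ M'.ideal.support
          rwa [hξ'']
        · rw [Scheme.IdealSheafData.support_comap]
          show τ ξ'' ∉ C.support
          rwa [hξ'']
      · -- `V(𝓘'') ⊆ τ⁻¹ V(𝓘')`, the controlled transform containing the total transform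
        intro x hx
        have hx' := Scheme.IdealSheafData.support_antitone
          (comap_le_controlledTransform τ C M'.ideal M'.mult) hx
        rw [Scheme.IdealSheafData.support_comap] at hx'
        exact hV' hx'

/-! ## BGMW §3.3 (1) ⇒ (4): a resolution of `(X, 𝓘_Y, E, 1)` desingularizes `Y` -/

/-- **A resolution of the marked ideal `(X, 𝓘_Y, E, 1)` yields a resolution of singularities of
`Y`** (BGMW 2011, §3.3, (1) ⇒ (2) ⇒ (3) ⇒ (4) in the weak form of `Scheme.HasResolution`; Kollár
2007, proof of Cor. 3.22). Let `ι : Y ↪ X` be a closed immersion of an integral scheme into a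
locally Noetherian scheme, `E` any boundary, and `σ : X' → X` a resolution of the marked ideal
`(X, 𝓘_Y, E, 1)` (`IsMarkedResolution`: blow-ups in regular centres `Cᵢ ⊆ supp(𝓘ᵢ, 1) = V(𝓘ᵢ)`
having snc with `Eᵢ`, with `supp(𝓘_r, 1) = ∅`). Then `Y` admits a proper birational morphism
from a regular scheme: by `IsMultipleBlowup.isEmbeddedTransform_or_isRegular` some centre must
pass through the point over the generic point of `Y` (otherwise that point survives in
`V(𝓘_r) = ∅`), at which stage the strict transform of `Y` is regular, and
`hasResolution_of_isEmbeddedTransform` applies.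
[cite: BierstoneGrigorievMilmanWlodarczyk2011, §3.3 (1)⇒(4), p. 7] -/
theorem IsMarkedResolution.hasResolution {X Y X' : Scheme.{u}} [IsLocallyNoetherian X]
    [IsIntegral Y] (ι : Y ⟶ X) [IsClosedImmersion ι] (E : List X.IdealSheafData) {σ : X' ⟶ X}
    {M' : MarkedIdeal X'} (h : IsMarkedResolution ⟨ι.ker, E, 1⟩ σ M') :
    Scheme.HasResolution Y := by
  set ξ : X := ι (genericPoint Y) with hξdef
  have hgen : IsGenericPoint ξ (Set.range ι) := by
    have := (genericPoint_spec Y).image ι.continuous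
    rwa [Set.image_univ, ι.isClosedEmbedding.isClosed_range.closure_eq] at this
  have hYξ : Set.range ι = closure {ξ} := hgen.symm
  have hsupp : ((ι.ker).support : Set X) = Set.range ι := by
    rw [Scheme.Hom.support_ker, ι.isClosedEmbedding.isClosed_range.closure_eq]
  have hξ : ξ ∈ (ι.ker).support := by
    rw [← SetLike.mem_coe, hsupp]
    exact Set.mem_range_self _
  have hV : ((ι.ker).support : Set X) ⊆ closure {ξ} := by rw [hsupp, hYξ]
  rcases h.1.isEmbeddedTransform_or_isRegular rfl hξ hV with
    ⟨X'', σ', Y', hET, hreg⟩ | ⟨Y', ξ', -, -, hξ'V, -, hμ'⟩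
  · rw [← hYξ] at hET
    exact hasResolution_of_isEmbeddedTransform stacks02NS_holds ι (T := {ξ}ᶜ) (by simp [hξdef])
      hET hreg
  · exfalso
    have hempty : M'.support = ∅ := h.2
    rw [M'.support_of_mult_eq_one hμ'] at hempty
    have : ξ' ∈ (M'.ideal.support : Set X') := hξ'V
    rw [hempty] at this
    exact this

/-! ## BGMW Thm. 8.0.5 (existence) for `(𝔸ⁿ, (S), ∅, 1)` implies Cor. 8.0.6: the reduction -/

/-- **BGMW Cor. 8.0.6 (weak non-embedded form) from Thm. 8.0.5 (existence clause) for the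
marked ideals `(𝔸ⁿ_k, (S), ∅, 1)`.** The HYPOTHESIS is the statement behind Cor. 8.0.7 ("There
is a canonical principlization of ideals `𝓘` in `𝔸ⁿ` described by `l` polynomials of degree
less than `n` [the paper's slip for: at most `d`], for which `M(d,n,l) < p`"), i.e. Thm. 8.0.5
("Assume the characteristic of base field is `p`. For any marked ideal `(X, 𝓘, E, μ)` such that
`M̄(X, 𝓘, E, μ) < p`, there is an associated resolution `(X_i)_{0 ≤ i ≤ m_X}`, called
canonical, …", resolution in the sense of Def. 3.1.3: blow-ups of smooth centres
`Cᵢ ⊆ supp(Xᵢ, 𝓘ᵢ, Eᵢ, μ)` having simple normal crossings with `Eᵢ`, controlled transforms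
`𝓘ᵢ = 𝓘(Dᵢ)^{-μ} σᵢ^*(𝓘ᵢ₋₁)`, `Eᵢ = σᵢᶜ(Eᵢ₋₁) ∪ {Dᵢ}`, and `supp(X_r, 𝓘_r, E_r, μ) = ∅`)
combined with Lemma 8.0.3 (1) (`M̄(X, 𝓘, x) ≤ M(d, n, l)`, `M(d,n,l) := M(n,d,n,l,1) ∈ 𝓔^{n+3}`
independent of the characteristic) and the Galois-descent Remark (p. 23: "existence of a
resolution over an algebraically closed field implies a resolution over any perfect field"),
read WEAKER than printed: existence only (canonicity and the étale functoriality (1)–(2)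
dropped), in the vocabulary of `MarkedIdeals.lean` (`IsMarkedResolution`; centres regular
schemes [printed: smooth], snc via `HasSNCWith`), for `X = 𝔸ⁿ_k = Spec k[x₁,…,xₙ]`,
`𝓘 = (affineZeroLocusι k n S).ker` the ideal sheaf of `Spec (k[x]⧸(S)) ↪ 𝔸ⁿ_k`, `E = ∅`,
`μ = 1`, `|S| ≤ l`, degrees `≤ d`, `k` perfect of characteristic `p > M(d, n, l)`, the
threshold existentially quantified (`∃ M : ℕ → ℕ → ℕ → ℕ`). The CONCLUSION is the named fact
`BierstoneGrigorievMilmanWlodarczyk2011` with the same threshold `M`: for integral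
`Y = Spec (k[x]⧸(S))` a resolution of `(𝔸ⁿ_k, 𝓘_Y, ∅, 1)` yields a proper birational morphism
onto `Y` from a regular scheme (`IsMarkedResolution.hasResolution`, BGMW §3.3 (1) ⇒ (4)).
The hypothesis is NOT a named fact of the tree (decomposition review, see the module docstring);
it is the proved conclusion of `marked_of_kollar_of_spreads` (`EffectiveResolutionSpread.lean`)
and of `bierstoneGrigorievMilmanWlodarczyk2011_marked_of_canonical` (`CanonicalResolution.lean`).
[cite: BierstoneGrigorievMilmanWlodarczyk2011, Cor. 8.0.6 from Thm. 8.0.5, Lemma 8.0.3 (1), Remark and Cor. 8.0.7 (p. 23), via §3.3] -/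
theorem bierstoneGrigorievMilmanWlodarczyk2011_of_marked
    (hM : ∃ M : ℕ → ℕ → ℕ → ℕ,
      ∀ (p : ℕ), p.Prime →
        ∀ (k : Type) [Field k] [CharP k p] [PerfectField k] (n d l : ℕ)
          (S : Finset (MvPolynomial (Fin n) k)),
          S.card ≤ l → (∀ f ∈ S, f.totalDegree ≤ d) → M d n l < p →
            ∃ (X' : Scheme.{0}) (σ : X' ⟶ Spec (CommRingCat.of (MvPolynomial (Fin n) k)))
              (M' : MarkedIdeal X'),
              IsMarkedResolution ⟨(affineZeroLocusι k n S).ker, [], 1⟩ σ M') :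
    BierstoneGrigorievMilmanWlodarczyk2011 := by
  obtain ⟨M, hM⟩ := hM
  refine ⟨M, fun p hp k _ _ _ n d l S hS hd hMp hint => ?_⟩
  obtain ⟨X', σ, M', hres⟩ := hM p hp k n d l S hS hd hMp
  haveI := hint
  exact hres.hasResolution (affineZeroLocusι k n S) []

end Literature.AlgebraicGeometry.Resolution

end
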